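/-
Copyright (c) 2026. All rights reserved.
Released under Apache 2.0 license as described in the file LICENSE.
Authors: abc-iut cell, wave-5 discharge prover seat abc-iut-w5-d242 (SUBDAG W6-S10 of [IUTchIII]
Prop 1.2; node IUTchIII:Prop1.2(ii)).
-/
import Literature.IUT.LogVolume.LocalUnitLog
import Literature.AnabelianGeometry.AbsoluteAnabelian.LogShellsOfUnitLog
import HarnessLib

/-!
# Galois-equivariance of the `p`-adic logarithm on units at the finite level

`log_p (σ x) = σ (log_p x)` for norm-preserving ring homomorphisms `σ`, and stability of
`log_p(𝒪_K^×)` and of the log-shell `ℐ_K` under norm-preserving ring isomorphisms.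

S. Mochizuki, *Topics in absolute anabelian geometry III*, J. Math. Sci. Univ. Tokyo 22 (2015)
[MochizukiAbsTopIII2015], Def 3.1 (i), manuscript p. 66: "the [`p`-adic] logarithm determines a
`Π_k`-equivariant isomorphism `log_k̄ : k~ ⥲ k̄`"; and *Inter-universal Teichmüller theory III*,
kurims manuscript (May 2020) [claim key `Mochizuki2012`, D-0012, status disputed], Def 1.1 (i) p. 24
and Rmk 1.1.2 (i) p. 30 l. 1–6 ("by applying the Galois-equivariance of the power series defining
the `p_v`-adic logarithm to relate automorphisms of the monoid `Ψ_{†F_v}` to [induced!]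
automorphisms of the monoid `Ψ~_{†F_v} = Ψ^{gp}_{log(†F_v)}`"), which is the content of
**[IUTchIII] Prop 1.2 (ii)** at `v ∈ V̲^{non}` ("the natural `†Π_v`-actions on the “Ψ's” appearing
in the diagram (∗non) are compatible with the ind-topological ring structures on `Ψ^{gp}_{†F_v}`
and `Ψ^{gp}_{log(†F_v)}`", kurims p. 31) and of the bookkeeping of `†Π_v`-invariants in Prop 1.2
(v)(b)(c) and (vi).

SUB-DAG `plan/L6/SUBDAG-IUTchIII-Prop-12.md` (holder abc-iut-w5-d242), rows Prop-12.ii.r6 and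
Prop-12.vi.r18, new intermediate statements N1–N3. At the `k̄`-level the equivariance is the
interface field `Literature.AnabelianGeometry.AbsoluteAnabelian.GaloisPadicLog.log_smul`, inhabited
for every MLF (`MLFClosure.galoisPadicLog`, abc-iut-L6-d2). THIS FILE proves the same thing at the
FINITE level of abc-iut-S1's concrete logarithm `Literature.IUT.LogVolume.unitLog`
(`LocalUnitLog.lean`) — the level at which the cell's log-shell models
(`PadicLogOnUnits.ofUnitLog p K`, [IUTchIII] Rmk 1.2.2 (i)) live — for an arbitrary NORM-PRESERVING
ring homomorphism `σ : K →+* K'` of `p`-adic fields. (Every `ℚ_p`-algebra automorphism of a finite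
extension `K/ℚ_p` is such a `σ`, by uniqueness of the extended absolute value; that classical input
is NOT re-proved here and enters as the hypothesis `hσ : ∀ x, ‖σ x‖ = ‖x‖`.)

* `logSeries_map` (N1): `σ (L y) = L (σ y)` for the logarithmic series `L` on principal units
  `‖1 − y‖ < 1` (a continuous additive map commutes with a convergent sum, and `σ` carries the
  terms of the series to the terms of the series);
* `isPrincipal_map_iff`, `unitLog_map` (N2): `log_p (σ x) = σ (log_p x)` for EVERY `x : K` (on units
  via `log_p x = k⁻¹ · L(x^k)` for any `k ≥ 1` with `x^k` principal — the SAME `k` works for `σ x`;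
  off the units, and when no such `k` exists, both sides are the junk value `0`);
* `image_logUnits_subset`, `image_logUnits` (N3): `σ '' log_p(𝒪_K^×) ⊆ log_p(𝒪_{K'}^×)`, with
  equality for a norm-preserving ring ISOMORPHISM; `image_preLogShell_ofUnitLog`,
  `image_logShell_ofUnitLog`: the pre-log-shell and the log-shell `ℐ_K = (p*)⁻¹ · log_p(𝒪_K^×)` of
  the standard model are carried onto those of `K'` (`σ (p*) = p*`); in particular (`K' = K`) they
  are STABLE under every isometric automorphism — the "`G_v(†Π_v)`-compatibility" clause of
  [IUTchIII] Prop 1.2 (vi) for the holomorphic log-shell at the model.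

Proof-only companion in the sense of DISCHARGE-W1 §0: no `def`, no new named fact; classical
`p`-adic analysis; nothing here bears on [IUTchIII] Cor. 3.12 and no side is taken.
-/

set_option autoImplicit false

noncomputable section

open Set Metric
open scoped Pointwise

namespace Literature.IUT.LogVolume

open Literature.AnabelianGeometry.AbsoluteAnabelian

variable (p : ℕ) [Fact p.Prime]
variable {K : Type*} [NontriviallyNormedField K] {K' : Type*} [NontriviallyNormedField K']

/-! ## N1: the logarithmic series commutes with norm-preserving ring homomorphisms -/

/-- A norm-preserving ring homomorphism is continuous (it is an isometry of the additive groups).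
[cite: MochizukiAbsTopIII2015, Def 3.1 (i) p. 66] -/
theorem continuous_of_norm_map (σ : K →+* K') (hσ : ∀ x, ‖σ x‖ = ‖x‖) : Continuous σ :=
  (AddMonoidHomClass.isometry_of_norm σ hσ).continuous

/-- A ring homomorphism maps the `n`-th term of the logarithmic series at `y` to the `n`-th term
at `σ y`. [cite: MochizukiAbsTopIII2015, Def 3.1 (i) p. 66] -/
theorem map_logSeries_term (σ : K →+* K') (y : K) (n : ℕ) :
    σ (-((1 - y) ^ (n + 1)) / (n + 1 : K)) = -((1 - σ y) ^ (n + 1)) / (n + 1 : K') := by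
  rw [map_div₀, map_neg, map_pow, map_sub, map_one]
  congr 1
  push_cast [map_add, map_natCast, map_one]
  ring

/-- A norm-preserving ring homomorphism preserves principal units: `‖1 − σ y‖ = ‖1 − y‖`.
[cite: MochizukiAbsTopIII2015, Def 3.1 (i) p. 66] -/
theorem norm_one_sub_map (σ : K →+* K') (hσ : ∀ x, ‖σ x‖ = ‖x‖) (y : K) :
    ‖1 - σ y‖ = ‖1 - y‖ := by
  rw [← hσ (1 - y), map_sub, map_one]

/-- **N1 (Galois-equivariance of the logarithmic series).** For a norm-preserving ring
homomorphism `σ : K →+* K'` of `p`-adic fields (`K` complete) and a principal unit `y`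
(`‖1 − y‖ < 1`): `σ (L(y)) = L(σ y)`, `L(y) = −Σ_{n≥1} (1−y)ⁿ/n` — "the Galois-equivariance of the
power series defining the `p_v`-adic logarithm" ([IUTchIII] Rmk 1.1.2 (i), kurims p. 30).
[cite: MochizukiAbsTopIII2015, Def 3.1 (i) p. 66] -/
theorem logSeries_map [NormedAlgebra ℚ_[p] K] [CompleteSpace K] (σ : K →+* K')
    (hσ : ∀ x, ‖σ x‖ = ‖x‖) {y : K} (hy : ‖1 - y‖ < 1) : σ (logSeries y) = logSeries (σ y) := by
  have h := (hasSum_logSeries p hy).map σ (continuous_of_norm_map σ hσ)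
  have h' : HasSum (fun n : ℕ ↦ -((1 - σ y) ^ (n + 1)) / (n + 1 : K')) (σ (logSeries y)) := by
    refine h.congr_fun ?_
    intro n
    exact (map_logSeries_term σ y n).symm
  exact (h'.tsum_eq).symm

/-! ## N2: `log_p (σ x) = σ (log_p x)` -/

/-- `(σ x)^k` is a principal unit iff `x^k` is. [cite: MochizukiAbsTopIII2015, Def 3.1 (i) p. 66] -/
theorem isPrincipal_map_pow_iff (σ : K →+* K') (hσ : ∀ x, ‖σ x‖ = ‖x‖) (x : K) (k : ℕ) :
    IsPrincipal (σ x ^ k) ↔ IsPrincipal (x ^ k) := by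
  rw [isPrincipal_iff, isPrincipal_iff, ← map_pow, norm_one_sub_map σ hσ]

/-- `σ x` is a principal unit iff `x` is. [cite: MochizukiAbsTopIII2015, Def 3.1 (i) p. 66] -/
theorem isPrincipal_map_iff (σ : K →+* K') (hσ : ∀ x, ‖σ x‖ = ‖x‖) (x : K) :
    IsPrincipal (σ x) ↔ IsPrincipal x := by
  simpa using isPrincipal_map_pow_iff σ hσ x 1

/-- **N2 = [IUTchIII] Prop 1.2 (ii) at `v ∈ V̲^{non}`, finite level** (kurims p. 31: "the natural
`†Π_v`-actions … are compatible with the ind-topological ring structures on `Ψ^{gp}_{†F_v}` and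
`Ψ^{gp}_{log(†F_v)}`"): the `p`-adic logarithm on units of abc-iut-S1 commutes with every
norm-preserving ring homomorphism `σ : K →+* K'` of complete `p`-adic fields —
`log_p (σ x) = σ (log_p x)` for ALL `x : K` (units: `log_p x = k⁻¹·L(x^k)` with the same exponent
`k` on both sides and N1; otherwise both sides are the junk value `0`). At the `k̄`-level this is
abc-iut-L4-t2's interface field `GaloisPadicLog.log_smul` ([AbsTopIII] Def 3.1 (i)).
[claim: Mochizuki2012, status: disputed] -/
theorem unitLog_map [NormedAlgebra ℚ_[p] K] [NormedAlgebra ℚ_[p] K']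
    [IsUltrametricDist K] [CompleteSpace K] [IsUltrametricDist K'] [CompleteSpace K']
    (σ : K →+* K') (hσ : ∀ x, ‖σ x‖ = ‖x‖) (x : K) : unitLog (σ x) = σ (unitLog x) := by
  haveI := Literature.NumberTheory.Transcendental.IwasawaLog.charZero p (F := K')
  by_cases h : ∃ k : ℕ, 0 < k ∧ IsPrincipal (x ^ k)
  · obtain ⟨k, hk, hkP⟩ := h
    have hkP' : IsPrincipal (σ x ^ k) := (isPrincipal_map_pow_iff σ hσ x k).mpr hkP
    rw [unitLog_eq_inv_mul_logSeries p hk hkP, unitLog_eq_inv_mul_logSeries p hk hkP', ← map_pow,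
      ← logSeries_map p σ hσ hkP, map_mul, map_inv₀, map_natCast]
  · have h' : ¬ ∃ k : ℕ, 0 < k ∧ IsPrincipal (σ x ^ k) := by
      rintro ⟨k, hk, hkP⟩
      exact h ⟨k, hk, (isPrincipal_map_pow_iff σ hσ x k).mp hkP⟩
    unfold unitLog
    rw [dif_neg h, dif_neg h', map_zero]

/-- N2 for a norm-preserving ring ISOMORPHISM, in `RingEquiv` form (e.g. an element of
`Gal(K/ℚ_p)` acting on a finite Galois extension `K` of `ℚ_p`, which is automatically isometric):
`log_p (σ x) = σ (log_p x)`. [claim: Mochizuki2012, status: disputed] -/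
theorem unitLog_map_ringEquiv [NormedAlgebra ℚ_[p] K] [NormedAlgebra ℚ_[p] K']
    [IsUltrametricDist K] [CompleteSpace K] [IsUltrametricDist K'] [CompleteSpace K']
    (σ : K ≃+* K') (hσ : ∀ x, ‖σ x‖ = ‖x‖) (x : K) : unitLog (σ x) = σ (unitLog x) :=
  unitLog_map p σ.toRingHom hσ x

/-! ## N3: stability of `log_p(𝒪_K^×)` and of the log-shell -/

/-- **N3 (pre-log-shell, inclusion).** A norm-preserving ring homomorphism maps `log_p(𝒪_K^×)`
into `log_p(𝒪_{K'}^×)` (it maps units to units and commutes with `log_p`).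
[claim: Mochizuki2012, status: disputed] -/
theorem image_logUnits_subset [NormedAlgebra ℚ_[p] K] [NormedAlgebra ℚ_[p] K']
    [IsUltrametricDist K] [CompleteSpace K] [IsUltrametricDist K'] [CompleteSpace K']
    (σ : K →+* K') (hσ : ∀ x, ‖σ x‖ = ‖x‖) : σ '' logUnits K ⊆ logUnits K' := by
  rintro _ ⟨_, ⟨u, hu, rfl⟩, rfl⟩
  rw [mem_setOf_eq] at hu
  exact ⟨σ u, by rw [mem_setOf_eq, hσ, hu], unitLog_map p σ hσ u⟩

/-- **N3 (pre-log-shell, equality)** = the `†Π_v`-equivariance of the (unscaled) pre-log-shell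
`log_p(𝒪_K^×)` ([IUTchIII] Def 1.1 (i) p. 24; Prop 1.2 (v)(c), (vi)): a norm-preserving ring
isomorphism carries `log_p(𝒪_K^×)` ONTO `log_p(𝒪_{K'}^×)`.
[claim: Mochizuki2012, status: disputed] -/
theorem image_logUnits [NormedAlgebra ℚ_[p] K] [NormedAlgebra ℚ_[p] K']
    [IsUltrametricDist K] [CompleteSpace K] [IsUltrametricDist K'] [CompleteSpace K']
    (σ : K ≃+* K') (hσ : ∀ x, ‖σ x‖ = ‖x‖) : σ '' logUnits K = logUnits K' := by
  refine Subset.antisymm (image_logUnits_subset p σ.toRingHom hσ) ?_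
  have hσ' : ∀ y, ‖σ.symm y‖ = ‖y‖ := fun y ↦ by
    rw [← hσ (σ.symm y), RingEquiv.apply_symm_apply]
  intro z hz
  have hmem : σ.symm z ∈ logUnits K := by
    have := image_logUnits_subset p σ.symm.toRingHom hσ' ⟨z, hz, rfl⟩
    simpa using this
  exact ⟨σ.symm z, hmem, σ.apply_symm_apply z⟩

omit [Fact p.Prime] in
/-- A ring homomorphism fixes `p* = p^{1 or 2}` (a natural number).
[claim: Mochizuki2012, status: disputed] -/
theorem map_pstarNat (σ : K →+* K') :
    σ (((p ^ (if p = 2 then 2 else 1) : ℕ) : K)) = ((p ^ (if p = 2 then 2 else 1) : ℕ) : K') :=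
  map_natCast σ _

/-- **N3 (pre-log-shell of the standard model).** `σ '' ℐ*_K = ℐ*_{K'}` for abc-iut-L4-t3's
`preLogShell (ofUnitLog p K) = log_p(𝒪_K^×)` ([AbsTopIII] Def 5.4 (iii)).
[claim: Mochizuki2012, status: disputed] -/
theorem image_preLogShell_ofUnitLog [NormedAlgebra ℚ_[p] K] [NormedAlgebra ℚ_[p] K']
    [IsUltrametricDist K] [CompleteSpace K] [IsUltrametricDist K'] [CompleteSpace K']
    (σ : K ≃+* K') (hσ : ∀ x, ‖σ x‖ = ‖x‖) :
    σ '' preLogShell (PadicLogOnUnits.ofUnitLog p K) =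
      preLogShell (PadicLogOnUnits.ofUnitLog p K') := by
  rw [preLogShell_ofUnitLog, preLogShell_ofUnitLog, image_logUnits p σ hσ]

/-- **N3 (log-shell) = the `G_v(†Π_v)`-compatibility of the holomorphic log-shell at the model**
([IUTchIII] Prop 1.2 (vi), kurims p. 32: "compatible with … the respective `†G_v`- and
`G_v(†Π_v)`-actions … the respective log-shells"): a norm-preserving ring isomorphism
`σ : K ≃+* K'` carries the log-shell `ℐ_K = (p*)⁻¹ · log_p(𝒪_K^×)` of the standard model
`ofUnitLog p K` onto `ℐ_{K'}` (`σ (p*) = p*`). [claim: Mochizuki2012, status: disputed] -/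
theorem image_logShell_ofUnitLog [NormedAlgebra ℚ_[p] K] [NormedAlgebra ℚ_[p] K']
    [IsUltrametricDist K] [CompleteSpace K] [IsUltrametricDist K'] [CompleteSpace K']
    (σ : K ≃+* K') (hσ : ∀ x, ‖σ x‖ = ‖x‖) :
    σ '' logShell (PadicLogOnUnits.ofUnitLog p K) = logShell (PadicLogOnUnits.ofUnitLog p K') := by
  rw [logShell_ofUnitLog, logShell_ofUnitLog, ← image_logUnits p σ hσ]
  have hc : σ (((p ^ (if p = 2 then 2 else 1) : ℕ) : K)⁻¹) =
      (((p ^ (if p = 2 then 2 else 1) : ℕ) : K'))⁻¹ := by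
    rw [map_inv₀, map_natCast]
  ext z
  simp only [mem_image, mem_smul_set, smul_eq_mul]
  constructor
  · rintro ⟨_, ⟨y, hy, rfl⟩, rfl⟩
    exact ⟨σ y, ⟨y, hy, rfl⟩, by rw [map_mul, hc]⟩
  · rintro ⟨_, ⟨y, hy, rfl⟩, rfl⟩
    exact ⟨_ * y, ⟨y, hy, rfl⟩, by rw [map_mul, hc]⟩

/-- **Stability under automorphisms** (`K' = K`): every norm-preserving ring automorphism `σ` of
`K` maps the log-shell `ℐ_K` of the standard model onto itself — the finite-level form of
"`I_{†F_v}` is the `†Π_v`-invariant part of a `†Π_v`-stable object" ([IUTchIII] Def 1.1 (i) p. 24).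
[claim: Mochizuki2012, status: disputed] -/
theorem image_logShell_ofUnitLog_self [NormedAlgebra ℚ_[p] K] [IsUltrametricDist K]
    [CompleteSpace K] (σ : K ≃+* K) (hσ : ∀ x, ‖σ x‖ = ‖x‖) :
    σ '' logShell (PadicLogOnUnits.ofUnitLog p K) = logShell (PadicLogOnUnits.ofUnitLog p K) :=
  image_logShell_ofUnitLog p σ hσ

/-- … hence `σ` restricts to a self-map of the log-shell (`MapsTo` form, for consumers phrasing
`G_v`-stability pointwise). [claim: Mochizuki2012, status: disputed] -/
theorem mapsTo_logShell_ofUnitLog [NormedAlgebra ℚ_[p] K] [IsUltrametricDist K]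
    [CompleteSpace K] (σ : K ≃+* K) (hσ : ∀ x, ‖σ x‖ = ‖x‖) :
    MapsTo σ (logShell (PadicLogOnUnits.ofUnitLog p K))
      (logShell (PadicLogOnUnits.ofUnitLog p K)) := by
  rw [mapsTo_iff_image_subset, image_logShell_ofUnitLog_self p σ hσ]

/-! ## Appendix: `ℚ_p`-algebra automorphisms are norm-preserving, hence the hypothesis-free forms -/

/-- **Uniqueness of the extended absolute value**: every `ℚ_p`-algebra automorphism `σ` of an
algebraic normed extension `K` of `ℚ_p` is norm-preserving, `‖σ x‖ = ‖x‖` — both `‖·‖` and `‖σ ·‖`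
are absolute values on `K` extending `|·|_p`, hence both equal the spectral norm (Mathlib
`spectralNorm_unique_field_norm_ext`, `spectralNorm_eq_of_equiv`). In particular every element of
`Gal(K/ℚ_p)` for a finite Galois `K/ℚ_p` (the `G_v`-action of [IUTchIII] Def 1.1 (i) on a finite
Galois layer) satisfies the hypothesis `hσ` of N1–N3. [cite: NeukirchANT1999, Ch. II (4.8)] -/
theorem norm_map_algEquiv [NormedAlgebra ℚ_[p] K] [Algebra.IsAlgebraic ℚ_[p] K]
    (σ : K ≃ₐ[ℚ_[p]] K) (x : K) : ‖σ x‖ = ‖x‖ := by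
  have h : ∀ y : K, ‖y‖ = spectralNorm ℚ_[p] K y := fun y =>
    spectralNorm_unique_field_norm_ext (K := ℚ_[p]) (L := K)
      (f := IsAbsoluteValue.toAbsoluteValue (norm : K → ℝ)) (fun c => norm_algebraMap' K c) y
  rw [h, h x]
  exact (spectralNorm_eq_of_equiv σ x).symm

/-- **[IUTchIII] Prop 1.2 (ii) at `v ∈ V̲^{non}`, finite Galois level, hypothesis-free**: for every
`ℚ_p`-algebra automorphism `σ` of a complete algebraic `p`-adic field `K` (e.g. `σ ∈ Gal(K/ℚ_p)`,
`K/ℚ_p` finite Galois), `log_p (σ x) = σ (log_p x)` for all `x : K`.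
[claim: Mochizuki2012, status: disputed] -/
theorem unitLog_map_algEquiv [NormedAlgebra ℚ_[p] K] [Algebra.IsAlgebraic ℚ_[p] K]
    [IsUltrametricDist K] [CompleteSpace K] (σ : K ≃ₐ[ℚ_[p]] K) (x : K) :
    unitLog (σ x) = σ (unitLog x) :=
  unitLog_map p (σ : K →+* K) (norm_map_algEquiv p σ) x

/-- `Gal`-stability of `log_p(𝒪_K^×)`, hypothesis-free: `σ '' log_p(𝒪_K^×) = log_p(𝒪_K^×)` for
every `ℚ_p`-algebra automorphism `σ` of `K`. [claim: Mochizuki2012, status: disputed] -/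
theorem image_logUnits_algEquiv [NormedAlgebra ℚ_[p] K] [Algebra.IsAlgebraic ℚ_[p] K]
    [IsUltrametricDist K] [CompleteSpace K] (σ : K ≃ₐ[ℚ_[p]] K) :
    σ '' logUnits K = logUnits K :=
  image_logUnits p (σ : K ≃+* K) (norm_map_algEquiv p σ)

/-- **`Gal`-stability of the holomorphic log-shell at the model, hypothesis-free** ([IUTchIII]
Prop 1.2 (vi): "compatible with … the respective `G_v(†Π_v)`-actions … the respective
log-shells"): `σ '' ℐ_K = ℐ_K` for every `ℚ_p`-algebra automorphism `σ` of the complete algebraic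
`p`-adic field `K`, `ℐ_K` the log-shell of the standard model `ofUnitLog p K`.
[claim: Mochizuki2012, status: disputed] -/
theorem image_logShell_ofUnitLog_algEquiv [NormedAlgebra ℚ_[p] K] [Algebra.IsAlgebraic ℚ_[p] K]
    [IsUltrametricDist K] [CompleteSpace K] (σ : K ≃ₐ[ℚ_[p]] K) :
    σ '' logShell (PadicLogOnUnits.ofUnitLog p K) = logShell (PadicLogOnUnits.ofUnitLog p K) :=
  image_logShell_ofUnitLog_self p (σ : K ≃+* K) (norm_map_algEquiv p σ)

end Literature.IUT.LogVolume

end
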